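import Summits.CriticalPhenomena.PercolationContinuityZ3.Theorems.Transplant.GrigorchukLamplighterDefs
import Summits.CriticalPhenomena.PercolationContinuityZ3.Theorems.Transplant.AutChartOrbitsCayleyCosets
import Summits.CriticalPhenomena.PercolationContinuityZ3.Theorems.Transplant.SkeletonFrmScaled1CustomersHoldsA
import Summits.CriticalPhenomena.PercolationContinuityZ3.Theorems.Transplant.CayleyRankCriticalProbLtOne
import HarnessLib

/-!
# `θ(p_c) = 0` AND `p_c < 1` ON CAYLEY GRAPHS OF THE PERMUTATIONAL WREATH PRODUCTS `ℤ² ≀_X 𝔊` (EVERY finite generating set) AND `ℤ ≀_X 𝔊`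
# (the lamp-complete generating set `{a, b, c, d, s, asa}`) OVER THE FIRST GRIGORCHUK GROUP — KERNEL THEOREMS; that these groups have
# INTERMEDIATE GROWTH is CITED (Bartholdi–Erschler 2012), not typed, and NOT used

builds on p205010 (kernel theorem, internal audit signed; external expert review pending): §1 runs through the U_s node («SkelFrmScaled1HoldsAll» via
`CayleyScaled.criticalContinuity_of_rank_holds`), §2 through the (N3-a) orbit theorem («AutChartOrbitsCriticalContinuity» p493117 via the coset front-end
«AutChartOrbitsCayleyCosets»), both of which build on p205010.  Lane `prim-bschramm`, seat `prim-bschramm-p3` gen 34 (DESIGN OWNER; `P3-NILPOTENT.md` §27,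
offer (O2), lead GO 2026-08-27 22:31Z).  Helper file (`--supports stmt-CriticalPhenomena-4575 --as helper`); PROOFS ONLY (def-free) over the definitions of
«GrigorchukLamplighterDefs» (`genA … genD` = the Grigorchuk generators as explicit permutations of `{0,1}^ℕ`, `wreathZ2 = ℤ² ≀_X 𝔊`, `wreathZ = ℤ ≀_X 𝔊` as
subgroups of the lamp group `(Ray →₀ M) ⋊ Perm(Ray)`, `lampSum`, `lampCompleteGens`, `stabOneW`, `blockChar`).  No `@[conjecture]` is declared, edited or
claimed; NOTHING is claimed about the end-state node or Conjecture 4 in general.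

* §1 **`wreathZ2_conj4 (S) (hS : closure S = ⊤) (g) : p_c(Cay(ℤ² ≀_X 𝔊; S)) < 1 ∧ θ_g(p_c) = 0`** — EVERY finite generating set: the total lamp sum
  `ε : ℤ² ≀_X 𝔊 → ℤ²` is a homomorphism of rank two (`ε(ρ ↦ eᵢ) = eᵢ`), so the U_s customer `CayleyScaled.criticalContinuity_of_rank_holds` and
  `CayleyRank.criticalProb_lt_one_of_rank` apply (`P3-NILPOTENT.md` §26.4's instance-by-citation, now a kernel theorem); `wreathZ2_theta_eq_zero_of_le`.
* §2 **`wreathZ_lampComplete_conj4 (g) : p_c(Cay(ℤ ≀_X 𝔊; a, b, c, d, s, asa)) < 1 ∧ θ_g(p_c) = 0`** — the orbit theorem on the two cosets of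
  `(⊕ ℤ) ⋊ St(1)`: transversal `{1, a}` (`genA ∉ stabOne`; every element's tree part preserves or flips all first letters — `firstLetter_dichotomy`, by
  closure induction), character `blockChar` = the two level-one lamp sums, scale `N = 1`: every letter value lies in `{0, ±e₀, ±e₁}` (`lip_letters`) and at
  both representatives the lamp letters `s^{±}`, `(asa)^{±}` realise `±e₀, ±e₁` along single edges (`step_letters`) — `P3-NILPOTENT.md` §27.1 binder by binder
  (refuter check 2026-08-27 #7510).  Bartholdi–Erschler's STANDARD generating set `{a, b, c, d, s}` is NOT covered (one lamp letter: `P3-NILPOTENT.md` §26.7).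
WHY IT MATTERS (cited, not typed): `ℤ ≀_X 𝔊` and `ℤ² ≀_X 𝔊` have growth `exp(n^{α₀} log n)`, `α₀ ≈ 0.7674` (Bartholdi–Erschler 2012, Lemma 5.1 / Thm. 5.3) —
neither virtually nilpotent nor of exponential growth, outside the Hermon–Hutchcroft heat-kernel class as far as print goes; `b₁(ℤ ≀_X 𝔊) = 1`.  The theorems
below hold for the groups AS DEFINED in «GrigorchukLamplighterDefs»; nothing about growth enters.
[cite: BenjaminiSchramm1996, Conj. 4; §2 (Cayley graphs)] [cite: BartholdiErschler2012, §2 (standard generating set), §3.1 (ρ = 1^∞ fixed by b, c, d), §5 / Thm. 5.3]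
[cite: Grigorchuk1980, definition of a, b, c, d] [cite: KozmaNitzan2024, §4 p. 16 (Lemma 8)]
-/

noncomputable section

namespace Summit.CriticalPhenomena.PercolationContinuityZ3.Theorems.Transplant

open SimpleGraph Literature.Probability.Percolation Literature.Probability.LatticeModels
open scoped Classical

namespace Grigorchuk

/-! ## §1 `W = ℤ² ≀_X 𝔊`: `p_c < 1` and `θ(p_c) = 0` for EVERY finite generating set (U_s) -/

/-- **The total lamp sum has rank two on `ℤ² ≀_X 𝔊`**: `ε(ρ ↦ e₀) = e₀`, `ε(ρ ↦ e₁) = e₁` (the two lamp letters of the standard generating set).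
[cite: BartholdiErschler2012, §2 (standard generating set S_A ∪ S_G)] -/
theorem wreathZ2_rank :
    ∃ x y : ↥wreathZ2, MaxArea.det2 (Multiplicative.toAdd (((lampSum (Fin 2 → ℤ)).comp wreathZ2.subtype) x))
      (Multiplicative.toAdd (((lampSum (Fin 2 → ℤ)).comp wreathZ2.subtype) y)) ≠ 0 := by
  refine ⟨⟨lamp rho (Pi.single 0 1), Subgroup.subset_closure (by simp)⟩, ⟨lamp rho (Pi.single 1 1), Subgroup.subset_closure (by simp)⟩, ?_⟩
  rw [MonoidHom.comp_apply, MonoidHom.comp_apply, Subgroup.subtype_apply, Subgroup.subtype_apply, lampSum_lamp, lampSum_lamp, toAdd_ofAdd,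
    toAdd_ofAdd, MaxArea.det2]
  simp

/-- **THEOREM (KERNEL): `p_c < 1` and `θ_g(p_c) = 0` at every vertex of EVERY Cayley graph of `W = ℤ² ≀_X 𝔊`** (every finite generating set `S`) — the U_s
customer for the rank-two homomorphism `ε` = total lamp sum.  (`W` has intermediate growth — Bartholdi–Erschler 2012, CITED, not used.)
builds on p205010 (kernel theorem, internal audit signed; external expert review pending).
[cite: BenjaminiSchramm1996, Conj. 4; §2 (Cayley graphs)] [cite: BartholdiErschler2012, §5 (ℤ^k ≀_X 𝔊)] -/
theorem wreathZ2_conj4 (S : Finset ↥wreathZ2) (hS : Subgroup.closure (↑S : Set ↥wreathZ2) = ⊤) (g : ↥wreathZ2) :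
    criticalProb (mulCayley (↑S : Set ↥wreathZ2)) g < 1 ∧
      theta (mulCayley (↑S : Set ↥wreathZ2)) g (criticalProbIOf (mulCayley (↑S : Set ↥wreathZ2)) g) = 0 :=
  ⟨CayleyRank.criticalProb_lt_one_of_rank _ wreathZ2_rank S hS g, CayleyScaled.criticalContinuity_of_rank_holds _ wreathZ2_rank S hS g⟩

/-- … and `θ_g(p) = 0` for every `p ≤ p_c`, every finite generating set. builds on p205010 (kernel theorem, internal audit signed; external expert review
pending). [cite: BenjaminiSchramm1996, Conj. 4; §2 (Cayley graphs)] -/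
theorem wreathZ2_theta_eq_zero_of_le (S : Finset ↥wreathZ2) (hS : Subgroup.closure (↑S : Set ↥wreathZ2) = ⊤) (g : ↥wreathZ2) {p : unitInterval}
    (hp : (p : ℝ) ≤ criticalProb (mulCayley (↑S : Set ↥wreathZ2)) g) : theta (mulCayley (↑S : Set ↥wreathZ2)) g p = 0 :=
  CayleyScaled.theta_eq_zero_of_le_of_rank_holds _ wreathZ2_rank S hS g hp

/-! ## §2 `Γ₂ = ℤ ≀_X 𝔊` with the lamp-complete generating set `{a, b, c, d, s, asa}` (the orbit theorem on the cosets of `(⊕ ℤ) ⋊ St(1)`) -/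

section GammaTwo

/-- `a` is an involution of the boundary. [cite: Grigorchuk1980, definition of a (a² = 1)] -/
theorem genA_mul_genA : genA * genA = 1 := by
  ext x n
  change flipAt 0 (flipAt 0 x) n = x n
  rw [flipAt_involutive 0 x]

/-- `a⁻¹ = a`. [cite: Grigorchuk1980, definition of a (a² = 1)] -/
theorem genA_inv : genA⁻¹ = genA := inv_eq_of_mul_eq_one_right genA_mul_genA

/-- `a (a ρ) = ρ`. [folklore] -/
theorem genA_genA_rho : genA (genA rho) = rho := by
  rw [← Equiv.Perm.mul_apply, genA_mul_genA, Equiv.Perm.one_apply]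

/-- The first letter of `ρ` is `1`. [cite: BartholdiErschler2012, §3.1 (ρ = 1^∞)] -/
theorem rho_zero : rho 0 = true := rfl

/-- The inverse of a lamp letter is the opposite lamp. [folklore] -/
theorem lamp_inv {M : Type} [AddCommGroup M] (x : Ray) (m : M) : (lamp x m : LampGroup M)⁻¹ = lamp x (-m) := by
  rw [lamp, lamp, ← map_inv]
  congr 1
  rw [← ofAdd_neg, Finsupp.single_neg]

/-- The coercions of the letters. [folklore] -/
theorem coe_aW : ((aW : ↥wreathZ) : LampGroup ℤ) = tree genA := rfl
/-- The coercions of the letters. [folklore] -/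
theorem coe_bW : ((bW : ↥wreathZ) : LampGroup ℤ) = tree genB := rfl
/-- The coercions of the letters. [folklore] -/
theorem coe_cW : ((cW : ↥wreathZ) : LampGroup ℤ) = tree genC := rfl
/-- The coercions of the letters. [folklore] -/
theorem coe_dW : ((dW : ↥wreathZ) : LampGroup ℤ) = tree genD := rfl
/-- The coercions of the letters. [folklore] -/
theorem coe_sW : ((sW : ↥wreathZ) : LampGroup ℤ) = lamp rho 1 := rfl
/-- The coercions of the letters. [folklore] -/
theorem coe_s'W : ((s'W : ↥wreathZ) : LampGroup ℤ) = lamp (genA rho) 1 := rfl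

/-- **`{a, b, c, d, s, asa}` generates `Γ₂`** (it contains the defining generators `{a, b, c, d, s}`). [cite: BartholdiErschler2012, §2 (standard generating set)] -/
theorem closure_lampCompleteGens : Subgroup.closure (↑lampCompleteGens : Set ↥wreathZ) = ⊤ := by
  have h := Subgroup.closure_closure_coe_preimage
    (k := ({tree genA, tree genB, tree genC, tree genD, lamp rho 1} : Set (LampGroup ℤ)))
  refine eq_top_iff.2 (le_trans (eq_top_iff.1 h) (Subgroup.closure_mono ?_))
  intro π hπ
  have hπ' : (π : LampGroup ℤ) ∈ ({tree genA, tree genB, tree genC, tree genD, lamp rho 1} : Set (LampGroup ℤ)) := hπ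
  simp only [lampCompleteGens, Finset.coe_insert, Finset.coe_singleton, Set.mem_insert_iff, Set.mem_singleton_iff] at hπ' ⊢
  rcases hπ' with h | h | h | h | h
  · exact Or.inl (Subtype.ext h)
  · exact Or.inr (Or.inl (Subtype.ext h))
  · exact Or.inr (Or.inr (Or.inl (Subtype.ext h)))
  · exact Or.inr (Or.inr (Or.inr (Or.inl (Subtype.ext h))))
  · exact Or.inr (Or.inr (Or.inr (Or.inr (Or.inl (Subtype.ext h)))))

/-- **First-letter dichotomy**: the tree part of every element of `Γ₂` either preserves the first letter of every ray or flips the first letter of every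
ray (true of the generators — `a` flips, `b, c, d` and the lamp preserve — and closed under products and inverses). [cite: Grigorchuk1980, definition of
a, b, c, d (action on the first level)] -/
theorem firstLetter_dichotomy (π : ↥wreathZ) :
    (∀ x : Ray, (π : LampGroup ℤ).right x 0 = x 0) ∨ (∀ x : Ray, (π : LampGroup ℤ).right x 0 = !x 0) := by
  obtain ⟨g, hg⟩ := π
  change (∀ x : Ray, g.right x 0 = x 0) ∨ (∀ x : Ray, g.right x 0 = !x 0)
  induction hg using Subgroup.closure_induction with
  | mem y hy =>
    simp only [Set.mem_insert_iff, Set.mem_singleton_iff] at hy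
    rcases hy with rfl | rfl | rfl | rfl | rfl
    · exact Or.inr fun x => by rw [tree_right, genA_apply_zero]
    · exact Or.inl fun x => by rw [tree_right]; exact genB_mem_stabOne x
    · exact Or.inl fun x => by rw [tree_right]; exact genC_mem_stabOne x
    · exact Or.inl fun x => by rw [tree_right]; exact genD_mem_stabOne x
    · exact Or.inl fun x => by rw [lamp_right, Equiv.Perm.one_apply]
  | one => exact Or.inl fun x => rfl
  | mul y z _ _ hy hz =>
    simp only [SemidirectProduct.mul_right, Equiv.Perm.mul_apply]
    rcases hy with hy | hy <;> rcases hz with hz | hz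
    · exact Or.inl fun x => by rw [hy, hz]
    · exact Or.inr fun x => by rw [hy, hz]
    · exact Or.inr fun x => by rw [hy, hz]
    · exact Or.inl fun x => by rw [hy, hz, Bool.not_not]
  | inv y _ hy =>
    simp only [SemidirectProduct.inv_right]
    rcases hy with hy | hy
    · refine Or.inl fun x => ?_
      have h := hy (y.right⁻¹ x)
      rw [Equiv.Perm.inv_def, Equiv.apply_symm_apply] at h
      rw [Equiv.Perm.inv_def]
      exact h.symm
    · refine Or.inr fun x => ?_
      have h := hy (y.right⁻¹ x)
      rw [Equiv.Perm.inv_def, Equiv.apply_symm_apply] at h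
      rw [Equiv.Perm.inv_def, h, Bool.not_not]

/-- `a ∉ (⊕ ℤ) ⋊ St(1)`. [cite: BartholdiErschler2012, §3.1 (a ∉ St(1))] -/
theorem aW_not_mem_stabOneW : aW ∉ stabOneW := fun h => genA_not_mem_stabOne (mem_stabOneW.1 h)

/-- `a⁻¹ ∉ (⊕ ℤ) ⋊ St(1)`. [cite: BartholdiErschler2012, §3.1 (a ∉ St(1))] -/
theorem aW_inv_not_mem_stabOneW : aW⁻¹ ∉ stabOneW := fun h => aW_not_mem_stabOneW ((Subgroup.inv_mem_iff _).1 h)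

/-- **`{1, a}` meets each coset of `(⊕ ℤ) ⋊ St(1)` at most once.** [cite: BartholdiErschler2012, §3.1 ([𝔊 : St(1)] = 2)] -/
theorem transversal_inj : ∀ r ∈ ({1, aW} : Finset ↥wreathZ), ∀ r' ∈ ({1, aW} : Finset ↥wreathZ), ∀ a : ↥stabOneW,
    (a : ↥wreathZ) * r = r' → r = r' := by
  intro r hr r' hr' a h
  simp only [Finset.mem_insert, Finset.mem_singleton] at hr hr'
  rcases hr with rfl | rfl <;> rcases hr' with rfl | rfl
  · rfl
  · exfalso
    rw [mul_one] at h
    exact aW_not_mem_stabOneW (h ▸ a.2)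
  · exfalso
    have ha : (a : ↥wreathZ) = aW⁻¹ := eq_inv_of_mul_eq_one_left h
    exact aW_inv_not_mem_stabOneW (ha ▸ a.2)
  · rfl

/-- **`{1, a}` meets every coset of `(⊕ ℤ) ⋊ St(1)`** (first-letter dichotomy). [cite: BartholdiErschler2012, §3.1 ([𝔊 : St(1)] = 2)] -/
theorem transversal_cover : ∀ g : ↥wreathZ, ∃ a : ↥stabOneW, ∃ r ∈ ({1, aW} : Finset ↥wreathZ), (a : ↥wreathZ) * r = g := by
  intro g
  rcases firstLetter_dichotomy g with h | h
  · exact ⟨⟨g, mem_stabOneW.2 h⟩, 1, by simp, mul_one g⟩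
  · refine ⟨⟨g * aW⁻¹, mem_stabOneW.2 fun x => ?_⟩, aW, by simp, inv_mul_cancel_right g aW⟩
    change ((g : LampGroup ℤ) * (aW : LampGroup ℤ)⁻¹).right x 0 = x 0
    rw [SemidirectProduct.mul_right, SemidirectProduct.inv_right, coe_aW, tree_right, genA_inv, Equiv.Perm.mul_apply, h, genA_apply_zero,
      Bool.not_not]

/-- The lamp part of `r·x·r′⁻¹` for lamp-free `r, r′` is the transported lamp part of `x`. [folklore] -/
theorem left_conj_eq {r x r' : LampGroup ℤ} (hr : r.left = 1) (hr' : r'.left = 1) : (r * x * r'⁻¹).left = lampAut ℤ r.right x.left := by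
  rw [SemidirectProduct.mul_left, SemidirectProduct.mul_left, SemidirectProduct.inv_left, hr, hr', one_mul, inv_one, map_one, map_one, mul_one]

/-- The representatives `1, a` are lamp-free. [folklore] -/
theorem left_eq_one_of_mem_transversal {r : ↥wreathZ} (hr : r ∈ ({1, aW} : Finset ↥wreathZ)) : (r : LampGroup ℤ).left = 1 := by
  simp only [Finset.mem_insert, Finset.mem_singleton] at hr
  rcases hr with rfl | rfl
  · rfl
  · rfl

/-- The block sums of a single lamp `±1` have sup-norm `≤ 1`. [folklore] -/
theorem abs_blockSum_single_le (y : Ray) {m : ℤ} (hm : m = 1 ∨ m = -1) (i : Fin 2) : |blockSum (Finsupp.single y m) i| ≤ 1 := by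
  rw [blockSum_single]
  by_cases hi : i = (if y 0 then (1 : Fin 2) else 0)
  · rw [hi, Pi.single_eq_same]
    rcases hm with rfl | rfl <;> simp
  · rw [Pi.single_eq_of_ne hi, abs_zero]
    exact zero_le_one

/-- The lamp part of a letter of `{a, b, c, d, s, asa}^{±}` transported by any permutation is `0` or a single lamp `±1`; hence its block sums have
sup-norm `≤ 1`. [folklore] -/
theorem abs_blockSum_letter_le {x : ↥wreathZ} (hx : x ∈ lampCompleteGens ∨ x⁻¹ ∈ lampCompleteGens) (g : Equiv.Perm Ray) (i : Fin 2) :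
    |blockSum (Multiplicative.toAdd (lampAut ℤ g (x : LampGroup ℤ).left)) i| ≤ 1 := by
  rw [toAdd_lampAut_apply]
  -- the lamp part of `x` is `1` or a single lamp `±1`
  have key : (x : LampGroup ℤ).left = 1 ∨ ∃ (y : Ray) (m : ℤ), (m = 1 ∨ m = -1) ∧ (x : LampGroup ℤ).left = Multiplicative.ofAdd (Finsupp.single y m) := by
    rcases hx with hx | hx
    · simp only [lampCompleteGens, Finset.mem_insert, Finset.mem_singleton] at hx
      rcases hx with rfl | rfl | rfl | rfl | rfl | rfl
      · exact Or.inl rfl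
      · exact Or.inl rfl
      · exact Or.inl rfl
      · exact Or.inl rfl
      · exact Or.inr ⟨rho, 1, Or.inl rfl, rfl⟩
      · exact Or.inr ⟨genA rho, 1, Or.inl rfl, rfl⟩
    · have e : x = (x⁻¹)⁻¹ := (inv_inv x).symm
      simp only [lampCompleteGens, Finset.mem_insert, Finset.mem_singleton] at hx
      rcases hx with h | h | h | h | h | h <;> rw [e, h]
      · left; change (tree genA : LampGroup ℤ)⁻¹.left = 1
        rw [SemidirectProduct.inv_left, tree_left, inv_one, map_one]
      · left; change (tree genB : LampGroup ℤ)⁻¹.left = 1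
        rw [SemidirectProduct.inv_left, tree_left, inv_one, map_one]
      · left; change (tree genC : LampGroup ℤ)⁻¹.left = 1
        rw [SemidirectProduct.inv_left, tree_left, inv_one, map_one]
      · left; change (tree genD : LampGroup ℤ)⁻¹.left = 1
        rw [SemidirectProduct.inv_left, tree_left, inv_one, map_one]
      · right; refine ⟨rho, -1, Or.inr rfl, ?_⟩
        change (lamp rho (1 : ℤ) : LampGroup ℤ)⁻¹.left = _
        rw [lamp_inv, lamp_left]
      · right; refine ⟨genA rho, -1, Or.inr rfl, ?_⟩
        change (lamp (genA rho) (1 : ℤ) : LampGroup ℤ)⁻¹.left = _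
        rw [lamp_inv, lamp_left]
  rcases key with h | ⟨y, m, hm, h⟩
  · rw [h, toAdd_one, Finsupp.equivMapDomain_zero, map_zero, Pi.zero_apply, abs_zero]
    exact zero_le_one
  · rw [h, toAdd_ofAdd, Finsupp.equivMapDomain_single]
    exact abs_blockSum_single_le _ hm i

/-- **`hlip` of §27.1**: every letter value `c a` (`r·x = a·r′`, `r, r′ ∈ {1, a}`, `x ∈ {a,b,c,d,s,asa}^{±}`) has sup-norm `≤ 1`.
[cite: BartholdiErschler2012, §2 (Cayley graph of a permutational wreath product: A-edges and G-edges)] -/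
theorem lip_letters : ∀ r ∈ ({1, aW} : Finset ↥wreathZ), ∀ x : ↥wreathZ, (x ∈ lampCompleteGens ∨ x⁻¹ ∈ lampCompleteGens) →
    ∀ (a : ↥stabOneW) (r' : ↥wreathZ), r' ∈ ({1, aW} : Finset ↥wreathZ) → r * x = (a : ↥wreathZ) * r' →
      ∀ i : Fin 2, |Multiplicative.toAdd (blockChar a) i| ≤ ((1 : ℕ) : ℤ) := by
  intro r hr x hx a r' hr' h i
  have ha : ((a : ↥wreathZ) : LampGroup ℤ) = (r : LampGroup ℤ) * (x : LampGroup ℤ) * (r' : LampGroup ℤ)⁻¹ := by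
    have h' : (a : ↥wreathZ) = r * x * r'⁻¹ := eq_mul_inv_of_mul_eq h.symm
    rw [h']; rfl
  rw [toAdd_blockChar, ha, left_conj_eq (left_eq_one_of_mem_transversal hr) (left_eq_one_of_mem_transversal hr'), Nat.cast_one]
  exact abs_blockSum_letter_le hx _ i

/-- `s^{±}, (asa)^{±} ∈ (⊕ ℤ) ⋊ St(1)` and their conjugates by `a`: lamp letters have trivial tree part. [folklore] -/
theorem lamp_mem_stabOneW {π : ↥wreathZ} (h : (π : LampGroup ℤ).right = 1) : π ∈ stabOneW :=
  mem_stabOneW.2 fun x => by rw [h, Equiv.Perm.one_apply]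

/-- The block character of an element with lamp part a single lamp. [folklore] -/
theorem toAdd_blockChar_of_left_eq (a : ↥stabOneW) {y : Ray} {m : ℤ}
    (h : (((a : ↥wreathZ) : LampGroup ℤ)).left = Multiplicative.ofAdd (Finsupp.single y m)) :
    Multiplicative.toAdd (blockChar a) = Pi.single (if y 0 then (1 : Fin 2) else 0) m := by
  rw [toAdd_blockChar, h, toAdd_ofAdd, blockSum_single]

/-- **`hstep` of §27.1**: at each representative `r ∈ {1, a}` and for each axis and sign, a lamp letter `x ∈ {s^{±}, (asa)^{±}}` with `r·x = a′·r`,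
`a′ ∈ (⊕ ℤ) ⋊ St(1)`, `c a′ = ± eᵢ` — at `1`: `asa ↦ e₀`, `s ↦ e₁`; at `a`: `s ↦ e₀` (`a s a⁻¹ = (ρa ↦ 1)`), `asa ↦ e₁` (`a (asa) a⁻¹ = (ρ ↦ 1)`).
[cite: BartholdiErschler2012, §2 (A-edges of the Cayley graph toggle the lamp at ρg⁻¹)] -/
theorem step_letters : ∀ r ∈ ({1, aW} : Finset ↥wreathZ), ∀ (i : Fin 2) (σ : ℤˣ), ∃ x : ↥wreathZ,
    (x ∈ lampCompleteGens ∨ x⁻¹ ∈ lampCompleteGens) ∧ ∃ (a : ↥stabOneW) (r' : ↥wreathZ), r' ∈ ({1, aW} : Finset ↥wreathZ) ∧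
      r * x = (a : ↥wreathZ) * r' ∧ Multiplicative.toAdd (blockChar a) = Pi.single i ((((1 : ℕ) : ℤ)) * σ) := by
  have hsm : sW ∈ lampCompleteGens := by simp [lampCompleteGens]
  have hs'm : s'W ∈ lampCompleteGens := by simp [lampCompleteGens]
  have h0 : (genA rho) 0 = false := genA_rho_zero
  -- the lamp letter pointing at axis `i`, seen from the identity (`i = 1 ↔ ρ`, `i = 0 ↔ aρ`), with sign `σ`
  intro r hr i σ
  rw [Nat.cast_one, one_mul]
  obtain ⟨m, hmσ, hm⟩ : ∃ m : ℤ, m = (σ : ℤ) ∧ (m = 1 ∨ m = -1) := by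
    rcases Int.units_eq_one_or σ with rfl | rfl
    · exact ⟨1, rfl, Or.inl rfl⟩
    · exact ⟨-1, rfl, Or.inr rfl⟩
  rw [← hmσ]
  -- the letter `x(y, m)` = the lamp `m` at `y ∈ {ρ, aρ}` as an element of `Γ₂`, and its membership in `S₂^{±}`
  have hxmem : ∀ y : Ray, (y = rho ∨ y = genA rho) → ∃ x : ↥wreathZ, (x ∈ lampCompleteGens ∨ x⁻¹ ∈ lampCompleteGens) ∧
      (x : LampGroup ℤ) = lamp y m := by
    intro y hy
    rcases hm with rfl | rfl
    · rcases hy with rfl | rfl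
      · exact ⟨sW, Or.inl hsm, rfl⟩
      · exact ⟨s'W, Or.inl hs'm, rfl⟩
    · rcases hy with rfl | rfl
      · refine ⟨sW⁻¹, Or.inr (by rw [inv_inv]; exact hsm), ?_⟩
        change (lamp rho (1 : ℤ) : LampGroup ℤ)⁻¹ = _
        rw [lamp_inv]
      · refine ⟨s'W⁻¹, Or.inr (by rw [inv_inv]; exact hs'm), ?_⟩
        change (lamp (genA rho) (1 : ℤ) : LampGroup ℤ)⁻¹ = _
        rw [lamp_inv]
  simp only [Finset.mem_insert, Finset.mem_singleton] at hr
  rcases hr with rfl | rfl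
  · -- r = 1: the letter itself is the coset element, r′ = 1
    -- axis 0 ↔ the lamp at `aρ` (first letter 0), axis 1 ↔ the lamp at `ρ` (first letter 1)
    obtain ⟨y, hy, hyi⟩ : ∃ y : Ray, (y = rho ∨ y = genA rho) ∧ (if y 0 then (1 : Fin 2) else 0) = i := by
      fin_cases i
      · exact ⟨genA rho, Or.inr rfl, by rw [h0]; rfl⟩
      · exact ⟨rho, Or.inl rfl, by rw [rho_zero]; rfl⟩
    obtain ⟨x, hxS, hx⟩ := hxmem y hy
    have hxst : x ∈ stabOneW := lamp_mem_stabOneW (by rw [hx, lamp_right])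
    refine ⟨x, hxS, ⟨x, hxst⟩, 1, by simp, by rw [one_mul, mul_one], ?_⟩
    rw [← hyi]
    exact toAdd_blockChar_of_left_eq ⟨x, hxst⟩ (by change (x : LampGroup ℤ).left = _; rw [hx, lamp_left])
  · -- r = a: conjugate the letter by `a`, r′ = a; `a` swaps the two lamp positions `ρ ↔ aρ`
    obtain ⟨y, hy, hyi⟩ : ∃ y : Ray, (y = rho ∨ y = genA rho) ∧ (if (genA y) 0 then (1 : Fin 2) else 0) = i := by
      fin_cases i
      · exact ⟨rho, Or.inl rfl, by rw [h0]; rfl⟩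
      · exact ⟨genA rho, Or.inr rfl, by rw [genA_genA_rho, rho_zero]; rfl⟩
    obtain ⟨x, hxS, hx⟩ := hxmem y hy
    -- a′ := a x a⁻¹ = the lamp `m` at `a y`
    have hconj : ((aW * x * aW⁻¹ : ↥wreathZ) : LampGroup ℤ) = lamp (genA y) m := by
      change (tree genA : LampGroup ℤ) * (x : LampGroup ℤ) * (tree genA : LampGroup ℤ)⁻¹ = _
      rw [hx, tree_mul_lamp_mul_tree_inv]
    have hst : aW * x * aW⁻¹ ∈ stabOneW := lamp_mem_stabOneW (by rw [hconj, lamp_right])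
    refine ⟨x, hxS, ⟨aW * x * aW⁻¹, hst⟩, aW, by simp, ?_, ?_⟩
    · change aW * x = aW * x * aW⁻¹ * aW
      rw [inv_mul_cancel_right]
    · rw [← hyi]
      exact toAdd_blockChar_of_left_eq ⟨_, hst⟩ (by change ((aW * x * aW⁻¹ : ↥wreathZ) : LampGroup ℤ).left = _; rw [hconj, lamp_left])

/-- **THEOREM (KERNEL): `p_c < 1` and `θ_g(p_c) = 0` at every vertex of `Cay(ℤ ≀_X 𝔊; a, b, c, d, s, asa)`** — the Cayley graph of Bartholdi–Erschler's
group `ℤ ≀_X 𝔊` (intermediate growth, CITED — not typed, not used; `b₁ = 1`) for the LAMP-COMPLETE generating set, through the (N3-a) orbit theorem on the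
two cosets of `(⊕ ℤ) ⋊ St(1)` with the block character and scale `1` (`P3-NILPOTENT.md` §27.1).  Bartholdi–Erschler's standard generating set
`{a, b, c, d, s}` is NOT covered by this theorem. builds on p205010 (kernel theorem, internal audit signed; external expert review pending).
[cite: BenjaminiSchramm1996, Conj. 4; §2 (Cayley graphs)] [cite: BartholdiErschler2012, §2, Thm. 5.3] [cite: KozmaNitzan2024, §4 p. 16 (Lemma 8)] -/
theorem wreathZ_lampComplete_conj4 (g : ↥wreathZ) :
    criticalProb (mulCayley (↑lampCompleteGens : Set ↥wreathZ)) g < 1 ∧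
      theta (mulCayley (↑lampCompleteGens : Set ↥wreathZ)) g (criticalProbIOf (mulCayley (↑lampCompleteGens : Set ↥wreathZ)) g) = 0 :=
  CayleyCosets.conj4_of_cosetLetters lampCompleteGens closure_lampCompleteGens stabOneW {1, aW} transversal_inj transversal_cover blockChar 1 le_rfl
    lip_letters step_letters g

/-- … and `θ_g(p) = 0` for every `p ≤ p_c`. builds on p205010 (kernel theorem, internal audit signed; external expert review pending).
[cite: BenjaminiSchramm1996, Conj. 4; §2 (Cayley graphs)] -/
theorem wreathZ_lampComplete_theta_eq_zero_of_le (g : ↥wreathZ) {p : unitInterval}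
    (hp : (p : ℝ) ≤ criticalProb (mulCayley (↑lampCompleteGens : Set ↥wreathZ)) g) :
    theta (mulCayley (↑lampCompleteGens : Set ↥wreathZ)) g p = 0 :=
  CayleyCosets.theta_eq_zero_of_le_of_cosetLetters lampCompleteGens closure_lampCompleteGens stabOneW {1, aW} transversal_inj transversal_cover
    blockChar 1 le_rfl lip_letters step_letters g hp

end GammaTwo

end Grigorchuk

end Summit.CriticalPhenomena.PercolationContinuityZ3.Theorems.Transplant

end
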